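import Mathlib
import Summits.CriticalPhenomena.PercolationContinuityZ3.Theorems.PercNearOneGluingNoHeavyLowerTailObserverUnionBound
import Summits.CriticalPhenomena.PercolationContinuityZ3.Theorems.PercNearOneGluingAdditiveGluingGoodStepStar
import HarnessLib

/-!
# `NoHeavyLowerTail` (stmt-CriticalPhenomena-4575) — FIRST-REACHING-UNIT GLUING
# (a composition principle: independent honest units at one observer glue at rate `θ + t/θ`)

Support file (depth prover `prim-nh-dp-blobmono` gen 7, 2026-08-19; `--supports stmt-CriticalPhenomena-4575`).
No definitions, no named facts, no sorries.

`μ = prodBernoulli w` on the pairs of `Fin n`, relays `A`, target `b`, observer `o`.  The neighbours of `o` are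
grouped into UNITS, one per attachment vertex `x ∈ X` (`o ∉ X`); each unit comes with an event `R x` ("`o` reaches a
relay THROUGH the unit of `x`") and a finite set of pairs `F x` such that

* (determination) `{s(o,x) open} ∩ R x` reads only the pairs in `F x`, and the `F x`, `x ∈ X`, are pairwise disjoint;
* (cover) `{o ↔ A} ⊆ ⋃_{x∈X} ({s(o,x) open} ∩ R x)` up to a `μ`-null set;
* (honesty) `μ({s(o,x) open} ∩ R x ∩ {x ↮ b off o}) ≤ t · μ({s(o,x) open} ∩ R x)` for every `x ∈ X`.

THEN (`firstUnit_gluing`) for every `θ > 0`: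

  `μ({o ↔ A} ∩ {o ↮ b}) ≤ θ + t/θ`   (so `≤ 2√t` with `θ = √t`).

Proof ("first reaching unit", no union bound): order `X`; on `{o ↔ A} ∩ {o ↮ b}` let `x` be the FIRST unit with
`{s(o,x) open} ∩ R x`; then `x ↮ b` off `o` (else `o ↔ b`) and all earlier units fail.  The term of `x` is at most
`min(t·u_x, u_x·P_x)` (`u_x = μ(unit x fires)`, `P_x = μ(all earlier units fail)`; independence from disjoint supports),
and `Σ_x min(t u_x, P_x − P_{x+1}) ≤ t/θ·Σ_{P_x>θ}(P_x − P_{x+1}) + Σ_{P_x≤θ}(P_x − P_{x+1}) ≤ t/θ + θ` (telescoping,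
`sum_le_aux`).  The point: `r`-uniformity (in the number of units) comes from the DISJOINTNESS of the first-firing events,
not from a union bound (which costs `Σ_x u_x`, the weighted degree — `ObserverUnionBound`).

Instances (separate files): relay neighbours (trivially honest), Kozma–Nitzan chains = spider legs with relay hairs
(honest by KN Thm 5 + good ⇒ pre-FKG + Harris) — giving KN Conjecture 3 on SPIDERS uniformly in the number AND the
length of the legs (`…NoHeavyLowerTailSpiderGluing.lean`).
-/

namespace Summit.CriticalPhenomena.PercolationContinuityZ3.Theorems

open MeasureTheory Set
open Literature.Probability.LatticeModels (prodBernoulli prodBernoulli_real_inter_of_determinedBy)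
open Literature.Probability.Percolation

noncomputable section
open Classical

variable {n : ℕ}

namespace FirstUnitGluing

/-! ### The arithmetic of the telescoping bound -/

/-- One step of the telescoping bound: if `m ≤ t·u` and `m ≤ u·P` with `0 ≤ u ≤ 1`, `0 ≤ P`, `0 ≤ t`, `0 < θ`, then
`m ≤ (t/θ)·(P − P(1−u)) + (min P θ − min (P(1−u)) θ)` (`u ≤ 1` is not needed). [this work] -/
theorem step_bound {t θ u P m : ℝ} (hθ : 0 < θ) (ht : 0 ≤ t) (hu0 : 0 ≤ u) (hP0 : 0 ≤ P)
    (hm1 : m ≤ t * u) (hm2 : m ≤ u * P) :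
    m ≤ t / θ * (P - P * (1 - u)) + (min P θ - min (P * (1 - u)) θ) := by
  have hPu : P * (1 - u) ≤ P := by nlinarith
  have hmin : min (P * (1 - u)) θ ≤ min P θ := min_le_min_right θ hPu
  have h1 : P - P * (1 - u) = u * P := by ring
  rw [h1]
  by_cases hP : P ≤ θ
  · -- late unit: use `m ≤ u P = min P θ − min (P(1−u)) θ`
    have e1 : min P θ = P := min_eq_left hP
    have e2 : min (P * (1 - u)) θ = P * (1 - u) := min_eq_left (hPu.trans hP)
    rw [e1, e2]
    have : 0 ≤ t / θ * (u * P) := mul_nonneg (div_nonneg ht hθ.le) (mul_nonneg hu0 hP0)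
    nlinarith
  · -- early unit: use `m ≤ t u ≤ (t/θ) u P`
    push Not at hP
    have hsub : 0 ≤ min P θ - min (P * (1 - u)) θ := sub_nonneg.2 hmin
    have key : t * u ≤ t / θ * (u * P) := by
      rw [div_mul_eq_mul_div, le_div_iff₀ hθ]
      have : t * u * θ ≤ t * u * P := mul_le_mul_of_nonneg_left hP.le (mul_nonneg ht hu0)
      linarith
    linarith

/-! ### The telescoping induction over the ordered set of units -/

/-- **Telescoping lemma.**  Units `x ∈ X` with firing events `U x` determined by pairwise disjoint finite pair sets
`F x`, arbitrary "defect" events `D x` with `μ(U x ∩ D x) ≤ t μ(U x)`, and a "past" event `N₀` determined off all the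
`F x`: then `Σ_{x∈X} μ(U x ∩ D x ∩ N₀ ∩ ⋂_{y<x} (U y)ᶜ) ≤ (t/θ)(μ N₀ − μ N_∞) + (min (μ N₀) θ − min (μ N_∞) θ)`,
`N_∞ := N₀ ∩ ⋂_{x∈X} (U x)ᶜ`.  Induction on `X` from its minimum. [this work] -/
theorem sum_le_aux (w : Sym2 (Fin n) → unitInterval) (t θ : ℝ) (ht : 0 ≤ t) (hθ : 0 < θ)
    (U D : Fin n → Set (BondConfig (Fin n))) (F : Fin n → Finset (Sym2 (Fin n))) (X : Finset (Fin n))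
    (hdet : ∀ x ∈ X, DeterminedBy (U x) (↑(F x) : Set (Sym2 (Fin n))))
    (hdisj : (↑X : Set (Fin n)).PairwiseDisjoint F)
    (hhon : ∀ x ∈ X, (prodBernoulli w).real (U x ∩ D x) ≤ t * (prodBernoulli w).real (U x)) :
    ∀ N₀ : Set (BondConfig (Fin n)), DeterminedBy N₀ (⋃ x ∈ X, (↑(F x) : Set (Sym2 (Fin n))))ᶜ →
      ∑ x ∈ X, (prodBernoulli w).real (U x ∩ D x ∩ (N₀ ∩ ⋂ y ∈ X.filter (· < x), (U y)ᶜ)) ≤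
        t / θ * ((prodBernoulli w).real N₀ - (prodBernoulli w).real (N₀ ∩ ⋂ x ∈ X, (U x)ᶜ)) +
          (min ((prodBernoulli w).real N₀) θ -
            min ((prodBernoulli w).real (N₀ ∩ ⋂ x ∈ X, (U x)ᶜ)) θ) := by
  set μ := prodBernoulli w with hμ
  induction X using Finset.induction_on_min with
  | empty =>
    intro N₀ _
    simp
  | insert a s has ih =>
    intro N₀ hN₀
    have has' : a ∉ s := fun h => lt_irrefl a (has a h)
    -- hypotheses restricted to `s`
    have hdet' : ∀ x ∈ s, DeterminedBy (U x) (↑(F x) : Set (Sym2 (Fin n))) :=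
      fun x hx => hdet x (Finset.mem_insert_of_mem hx)
    have hdisj' : (↑s : Set (Fin n)).PairwiseDisjoint F :=
      hdisj.subset (by simp)
    have hhon' : ∀ x ∈ s, μ.real (U x ∩ D x) ≤ t * μ.real (U x) :=
      fun x hx => hhon x (Finset.mem_insert_of_mem hx)
    -- the new past `N₀' = N₀ ∩ (U a)ᶜ` is determined off `⋃_{x∈s} F x`
    have hFa : (↑(F a) : Set (Sym2 (Fin n))) ⊆ (⋃ x ∈ s, (↑(F x) : Set (Sym2 (Fin n))))ᶜ := by
      intro e he hes
      simp only [mem_iUnion, Finset.mem_coe, exists_prop] at hes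
      obtain ⟨x, hx, hex⟩ := hes
      have hax : a ≠ x := fun h => has' (h ▸ hx)
      exact Finset.disjoint_left.1 (hdisj (Finset.mem_insert_self a s) (Finset.mem_insert_of_mem hx) hax)
        he hex
    have hN₀s : DeterminedBy N₀ (⋃ x ∈ s, (↑(F x) : Set (Sym2 (Fin n))))ᶜ := by
      refine hN₀.mono (compl_subset_compl.2 ?_)
      intro e he
      simp only [mem_iUnion, Finset.mem_coe, exists_prop] at he ⊢
      obtain ⟨x, hx, hex⟩ := he
      exact ⟨x, Finset.mem_insert_of_mem hx, hex⟩
    have hN₀' : DeterminedBy (N₀ ∩ (U a)ᶜ) (⋃ x ∈ s, (↑(F x) : Set (Sym2 (Fin n))))ᶜ :=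
      hN₀s.inter ((goodStep_determinedBy_compl (hdet a (Finset.mem_insert_self a s))).mono hFa)
    have IH := ih hdet' hdisj' hhon' (N₀ ∩ (U a)ᶜ) hN₀'
    -- independence of the unit `a` from the past
    have hN₀a : DeterminedBy N₀ (↑(F a) : Set (Sym2 (Fin n)))ᶜ := by
      refine hN₀.mono (compl_subset_compl.2 ?_)
      intro e he
      simp only [mem_iUnion, Finset.mem_coe, exists_prop]
      exact ⟨a, Finset.mem_insert_self a s, he⟩
    have hind : μ.real (U a ∩ N₀) = μ.real (U a) * μ.real N₀ :=
      prodBernoulli_real_inter_of_determinedBy w (F a) (hdet a (Finset.mem_insert_self a s)) hN₀a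
        MeasurableSet.of_discrete MeasurableSet.of_discrete
    -- `μ(N₀ ∩ (U a)ᶜ) = μ N₀ · (1 - μ(U a))`
    have hsplit : μ.real (N₀ ∩ (U a)ᶜ) = μ.real N₀ * (1 - μ.real (U a)) := by
      have h := measureReal_inter_add_sdiff (μ := μ) (s := N₀) (t := U a) MeasurableSet.of_discrete
      rw [Set.sdiff_eq, inter_comm N₀ (U a), hind] at h
      linarith
    -- the two pieces of the sum
    rw [Finset.sum_insert has']
    -- the term of `a`: no earlier unit
    have hfa : (insert a s).filter (· < a) = ∅ := by
      refine Finset.filter_eq_empty_iff.2 fun y hy hya => ?_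
      rcases Finset.mem_insert.1 hy with rfl | hy
      · exact lt_irrefl _ hya
      · exact lt_asymm hya (has y hy)
    have hterm_a : μ.real (U a ∩ D a ∩ (N₀ ∩ ⋂ y ∈ (insert a s).filter (· < a), (U y)ᶜ)) =
        μ.real (U a ∩ D a ∩ N₀) := by
      rw [hfa]
      simp
    -- the terms of `x ∈ s`: the earlier units are `a` and the earlier units within `s`
    have hterm_s : ∀ x ∈ s, μ.real (U x ∩ D x ∩ (N₀ ∩ ⋂ y ∈ (insert a s).filter (· < x), (U y)ᶜ)) =
        μ.real (U x ∩ D x ∩ ((N₀ ∩ (U a)ᶜ) ∩ ⋂ y ∈ s.filter (· < x), (U y)ᶜ)) := by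
      intro x hx
      have hfx : (insert a s).filter (· < x) = insert a (s.filter (· < x)) := by
        rw [Finset.filter_insert, if_pos (has x hx)]
      rw [hfx, Finset.set_biInter_insert]
      simp only [inter_assoc]
    rw [hterm_a, Finset.sum_congr rfl hterm_s]
    -- bound for the term of `a`
    have hu0 : 0 ≤ μ.real (U a) := measureReal_nonneg
    have hP0 : 0 ≤ μ.real N₀ := measureReal_nonneg
    have hm1 : μ.real (U a ∩ D a ∩ N₀) ≤ t * μ.real (U a) :=
      (measureReal_mono inter_subset_left (measure_ne_top _ _)).trans
        (hhon a (Finset.mem_insert_self a s))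
    have hm2 : μ.real (U a ∩ D a ∩ N₀) ≤ μ.real (U a) * μ.real N₀ := by
      rw [← hind]
      exact measureReal_mono (fun ω hω => ⟨hω.1.1, hω.2⟩) (measure_ne_top _ _)
    have step := step_bound (m := μ.real (U a ∩ D a ∩ N₀)) hθ ht hu0 hP0 hm1 hm2
    rw [← hsplit] at step
    -- assemble
    have hfinal : N₀ ∩ (U a)ᶜ ∩ ⋂ x ∈ s, (U x)ᶜ = N₀ ∩ ⋂ x ∈ insert a s, (U x)ᶜ := by
      rw [Finset.set_biInter_insert, inter_assoc]
    rw [hfinal] at IH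
    have e : t / θ * (μ.real N₀ - μ.real (N₀ ∩ (U a)ᶜ)) + (min (μ.real N₀) θ - min (μ.real (N₀ ∩ (U a)ᶜ)) θ) +
        (t / θ * (μ.real (N₀ ∩ (U a)ᶜ) - μ.real (N₀ ∩ ⋂ x ∈ insert a s, (U x)ᶜ)) +
          (min (μ.real (N₀ ∩ (U a)ᶜ)) θ - min (μ.real (N₀ ∩ ⋂ x ∈ insert a s, (U x)ᶜ)) θ)) =
        t / θ * (μ.real N₀ - μ.real (N₀ ∩ ⋂ x ∈ insert a s, (U x)ᶜ)) +
          (min (μ.real N₀) θ - min (μ.real (N₀ ∩ ⋂ x ∈ insert a s, (U x)ᶜ)) θ) := by ring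
    linarith [step, IH, e]

/-! ### The composition theorem -/

/-- **First-reaching-unit gluing.**  Let `o ∉ X` and, for each attachment vertex `x ∈ X`, let `R x` be an event and
`F x` a finite set of pairs such that `{s(o,x) open} ∩ R x` is determined by `F x`, the `F x` are pairwise disjoint,
`{o ↔ A}` is covered by `⋃_{x∈X} ({s(o,x) open} ∩ R x)` up to a null set, and each unit is HONEST:
`μ({s(o,x) open} ∩ R x ∩ {x ↮ b off o}) ≤ t · μ({s(o,x) open} ∩ R x)`.  Then for every `θ > 0`,
`μ({o ↔ A} ∩ {o ↮ b}) ≤ θ + t/θ`. [this work] -/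
theorem firstUnit_gluing (w : Sym2 (Fin n) → unitInterval) (A X : Finset (Fin n)) (o b : Fin n) (hoX : o ∉ X)
    (R : Fin n → Set (BondConfig (Fin n))) (F : Fin n → Finset (Sym2 (Fin n)))
    (hdet : ∀ x ∈ X, DeterminedBy ({ω : BondConfig (Fin n) | s(o, x) ∈ ω} ∩ R x) (↑(F x) : Set (Sym2 (Fin n))))
    (hdisj : (↑X : Set (Fin n)).PairwiseDisjoint F) (t : ℝ) (ht : 0 ≤ t)
    (hhon : ∀ x ∈ X, (prodBernoulli w).real ({ω : BondConfig (Fin n) | s(o, x) ∈ ω} ∩ R x ∩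
        (openConnIn ({o}ᶜ : Set (Fin n)) x b)ᶜ) ≤
      t * (prodBernoulli w).real ({ω : BondConfig (Fin n) | s(o, x) ∈ ω} ∩ R x))
    (hcov : (prodBernoulli w).real ((⋃ a ∈ A, (openConn o a : Set (BondConfig (Fin n)))) \
      ⋃ x ∈ X, ({ω : BondConfig (Fin n) | s(o, x) ∈ ω} ∩ R x)) = 0)
    (θ : ℝ) (hθ : 0 < θ) :
    (prodBernoulli w).real ((⋃ a ∈ A, (openConn o a : Set (BondConfig (Fin n)))) ∩ (openConn o b)ᶜ) ≤
      θ + t / θ := by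
  set μ := prodBernoulli w with hμ
  set U : Fin n → Set (BondConfig (Fin n)) := fun x => {ω : BondConfig (Fin n) | s(o, x) ∈ ω} ∩ R x with hU
  set D : Fin n → Set (BondConfig (Fin n)) := fun x => (openConnIn ({o}ᶜ : Set (Fin n)) x b)ᶜ with hD
  set E₀ : Set (BondConfig (Fin n)) := ⋃ a ∈ A, (openConn o a : Set (BondConfig (Fin n))) with hE₀
  -- the first reaching unit
  have hincl : E₀ ∩ (openConn o b)ᶜ ⊆ (E₀ \ ⋃ x ∈ X, U x) ∪
      ⋃ x ∈ X, (U x ∩ D x ∩ (univ ∩ ⋂ y ∈ X.filter (· < x), (U y)ᶜ)) := by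
    intro ω hω
    by_cases hex : ω ∈ ⋃ x ∈ X, U x
    · right
      simp only [mem_iUnion, exists_prop] at hex
      obtain ⟨x₁, hx₁X, hx₁U⟩ := hex
      set S : Finset (Fin n) := X.filter (fun x => ω ∈ U x) with hS
      have hSne : S.Nonempty := ⟨x₁, Finset.mem_filter.2 ⟨hx₁X, hx₁U⟩⟩
      set x₀ := S.min' hSne with hx₀
      have hx₀S : x₀ ∈ S := Finset.min'_mem S hSne
      have hx₀X : x₀ ∈ X := (Finset.mem_filter.1 hx₀S).1
      have hx₀U : ω ∈ U x₀ := (Finset.mem_filter.1 hx₀S).2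
      have hx₀o : x₀ ≠ o := fun h => hoX (h ▸ hx₀X)
      simp only [mem_iUnion, exists_prop]
      refine ⟨x₀, hx₀X, ⟨⟨hx₀U, ?_⟩, mem_univ _, ?_⟩⟩
      · -- `x₀ ↮ b` off `o`, else `o ↔ b`
        intro hb
        exact hω.2 (ObserverUnionBound.openConn_of_edge_of_openConnIn hx₀o hx₀U.1 hb)
      · -- all earlier units fail
        simp only [mem_iInter]
        intro y hy hyU
        have hyS : y ∈ S := Finset.mem_filter.2 ⟨(Finset.mem_filter.1 hy).1, hyU⟩
        exact absurd (Finset.mem_filter.1 hy).2 (not_lt.2 (Finset.min'_le S y hyS))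
    · left
      exact ⟨hω.1, hex⟩
  -- measure bookkeeping
  have hdetU : ∀ x ∈ X, DeterminedBy (U x) (↑(F x) : Set (Sym2 (Fin n))) := hdet
  have hsum := sum_le_aux w t θ ht hθ U D F X hdetU hdisj hhon univ (determinedBy_univ _)
  have h1 : μ.real (E₀ ∩ (openConn o b)ᶜ) ≤ μ.real (E₀ \ ⋃ x ∈ X, U x) +
      μ.real (⋃ x ∈ X, (U x ∩ D x ∩ (univ ∩ ⋂ y ∈ X.filter (· < x), (U y)ᶜ))) :=
    (measureReal_mono hincl (measure_ne_top _ _)).trans (measureReal_union_le _ _)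
  have h2 : μ.real (⋃ x ∈ X, (U x ∩ D x ∩ (univ ∩ ⋂ y ∈ X.filter (· < x), (U y)ᶜ))) ≤
      ∑ x ∈ X, μ.real (U x ∩ D x ∩ (univ ∩ ⋂ y ∈ X.filter (· < x), (U y)ᶜ)) :=
    measureReal_biUnion_finset_le _ _
  have h3 : μ.real (E₀ \ ⋃ x ∈ X, U x) = 0 := hcov
  have huniv : μ.real (univ : Set (BondConfig (Fin n))) = 1 := probReal_univ
  have hq0 : 0 ≤ μ.real (univ ∩ ⋂ x ∈ X, (U x)ᶜ) := measureReal_nonneg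
  have hq1 : 0 ≤ min (μ.real (univ ∩ ⋂ x ∈ X, (U x)ᶜ)) θ := le_min hq0 hθ.le
  have hm1 : min (μ.real (univ : Set (BondConfig (Fin n)))) θ ≤ θ := min_le_right _ _
  have htθ : 0 ≤ t / θ := div_nonneg ht hθ.le
  have h4 : t / θ * (μ.real (univ : Set (BondConfig (Fin n))) - μ.real (univ ∩ ⋂ x ∈ X, (U x)ᶜ)) ≤ t / θ := by
    rw [huniv]
    have : 1 - μ.real (univ ∩ ⋂ x ∈ X, (U x)ᶜ) ≤ 1 := by linarith
    calc t / θ * (1 - μ.real (univ ∩ ⋂ x ∈ X, (U x)ᶜ)) ≤ t / θ * 1 :=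
          mul_le_mul_of_nonneg_left this htθ
      _ = t / θ := mul_one _
  linarith [h1, h2, h3, hsum, h4, hq1, hm1]

end FirstUnitGluing

end

end Summit.CriticalPhenomena.PercolationContinuityZ3.Theorems
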